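import Mathlib.NumberTheory.Zsqrtd.GaussianInt
import Mathlib.Algebra.BigOperators.Group.Finset.Basic
import Mathlib.Tactic.IntervalCases
import Mathlib.Tactic.Linarith
import Mathlib.Tactic.Ring
import HarnessLib

/-!
# `(1+i)`-ary digit expansions of Gaussian integers: the sets `B_n`, the widths `w_n`, the octagons
# `Oct_n`, and the explicit description of `B_n` (Graves 2023, §2)

Topic `Literature/NumberTheory/QuadraticFields`, namespace `Literature.NumberTheory.QuadraticFields.GaussianDigits`
(the Gaussian integers are Mathlib's `ℤ√(-1) = GaussianInt`).  Four definitions with bodies (`digits`,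
`digitSet`, `width`, `octagon` — Graves' `B₀ = {0, ±1, ±i}`, `B_n`, `w_n`, `Oct_n`); everything else PROVED; no
named fact, no instance.  First of three files formalising Graves' paper (the others:
`GaussianTwoSquaresResidueSystem.lean` = §4, `GaussianMinimalEuclideanFunction.lean` = §§3, 5).

## Source (read at the page)

H. Graves, *The minimal Euclidean function on the Gaussian integers*, Indag. Math. (N.S.) **34** (2023) 78–88
[Graves2023] (materialised `paper:arxiv-1802.08281`, pp. 2–6), VERBATIM:
* Def. 2.1: «We define the sets `B_n` to be the Gaussian integers that can be written with `n+1` ‘digits,’ i.e.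
  `B_n = {Σ_{j=0}^n v_j (1+i)^j, v_j ∈ {0, ±1, ±i}}`.» followed by: «The sets `B_n` […] are closed under complex
  conjugation and multiplication by elements of `B₀ = {0, ±1, ±i}`. If `a+bi ∈ B_n`, then
  `(1+i)^j (a+bi) ∈ B_{n+j}`. Similarly, if `2^j` divides both `a` and `b` for some `a+bi ∈ B_n`, then
  `a/2^j + (b/2^j) i ∈ B_{n−2j}`.»
* Lemma 2.2: «If `x ∈ B_k` and `(1+i)^{k+1} ∣ x`, then `x = 0`.»
* Def. 2.3: «`w_k = 2^{n+1} + 2^n` if `k = 2n`, `w_k = 2^{n+2}` if `k = 2n+1`.»  (So `w₀ = 3`, `w₁ = 4` and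
  `w_{k+2} = 2 w_k`; the printed «if `k ≥ 2`, then `w_k = 2w_{k−1}`» is a misprint for `w_{k−2}`.)
* Def. 2.4: «`Oct_n := {x+yi : |x|, |y| ≤ w_n − 2, |x| + |y| ≤ w_{n+1} − 3}`.»
* Theorem 2.5: «The set `B_n ∖ 0` equals the union
  `⋃_{j=0}^{⌊n/2⌋} {x+iy : 2^j ∥ (x,y); |x|, |y| ≤ w_n − 2^{j+1}; |x|+|y| ≤ w_{n+1} − 3·2^j}`.»
* Corollary 2.6: «`B_n ⊂ Oct_n ⊂ B_{n+1} ∪ {(1+i)^{n+2} (ℤ[i])^×}`. If `a+bi ∈ Oct_n`, `2 ∤ (a,b)`, then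
  `a+bi ∈ B_n`.»  Corollary 2.7: «If `xy ∈ B_n ∖ 0`, then `x ∈ B_n`.»

## Design, and how the proofs differ from the printed ones

* `digitSet` is defined by the BOTTOM-digit recursion `B_{n+1} = B₀ + (1+i)·B_n`; `mem_digitSet_iff_exists_sum`
  proves that this is Def. 2.1 verbatim, and `add_mul_pow_mem_digitSet` is the top-digit recursion
  `B_n + v(1+i)^{n+1} ⊆ B_{n+1}` used in the printed proofs.
* «`2^j ∥ (x,y)`» is spelled `2^j ∣ x ∧ 2^j ∣ y ∧ ¬(2^{j+1} ∣ x ∧ 2^{j+1} ∣ y)`; «`2 ∤ (a,b)`» is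
  `¬(2 ∣ a ∧ 2 ∣ b)`.
* Theorem 2.5 is NOT proved by the printed top-digit induction (two pages of inequalities whose text layer
  carries several misprints) but by three short `(1+i)`-adic facts: (A) `B_n ⊆ Oct_n` (`digitSet_subset_octagon`,
  bottom-digit induction); (P) an `x+yi ∈ Oct_n` with `2 ∤ (x,y)` lies in `B_n` (`mem_digitSet_of_not_two_dvd`,
  induction: strip the bottom digit so that the quotient by `1+i` is again of this kind); (D) `2z ∈ B_{n+2} ↔
  z ∈ B_n` and `2z ∉ B₀ ∪ B₁` for `z ≠ 0` (`two_mul_mem_digitSet_iff`; `2 = −i(1+i)²`).  Writing `z = 2^j z₀`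
  with `2 ∤ z₀` and `w_{m+2j} = 2^j w_m` gives Theorem 2.5 (`mem_digitSet_iff`), in particular the
  exact-valuation criterion `mem_digitSet_iff_of_exact` used in §5.  Corollary 2.7 is proved by stripping
  factors `1+i` from `x` and, for `(1+i) ∤ x`, the inequalities `|x|_∞ ≤ |xy|_∞`, `|x|_1 ≤ |xy|_1`
  (`N(y) ≥ 2`), replacing the printed sign discussion.  Corollary 2.6 is formalised in all three parts
  (`digitSet_subset_octagon`, `mem_digitSet_succ_or_of_mem_octagon` (§6, through the exact-valuation
  criterion), `mem_digitSet_of_not_two_dvd`).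

## Main statements

`digitSet_subset_octagon` (Cor. 2.6, first inclusion), `mem_digitSet_of_not_two_dvd` (Cor. 2.6, last sentence),
`mem_digitSet_succ_or_of_mem_octagon` (Cor. 2.6, middle inclusion),
`eq_zero_of_pow_dvd_of_mem_digitSet` (Lemma 2.2), `two_pow_mul_mem_digitSet_iff` (Def. 2.1, remark),
`mem_digitSet_iff` (THEOREM 2.5), `mem_digitSet_iff_of_exact` / `mem_digitSet_of_forall_pow_dvd` (working forms),
`mem_digitSet_of_mul_mem` (Cor. 2.7), `mem_digitSet_iff_exists_sum` (Def. 2.1 as printed).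

## Mathlib / tree search

Mathlib: `Zsqrtd` (`re_mul`, `im_mul`, `Zsqrtd.ext`, `star_mk`), `Int.le_of_dvd`, `Finset.sum_range_succ'`;
`GaussianInt` is `ℤ√(-1)` (`abbrev`) with its `EuclideanDomain` structure — nothing on digit expansions
(`lean search 'digit|radix' --decl` restricted to `Zsqrtd|GaussianInt`: no hits).  Tree: the universal side
divisors of `ℤ[i]` (`ImaginaryQuadraticUniversalSideDivisors.lean`: `ZSqrt.isUnit_iff_neg_one`, … = Graves'
`B₁ ∖ B₀`) and Motzkin's construction (`Literature.Algebra.EuclideanDomain.MotzkinConstruction`), used in §5's file.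
-/

namespace Literature.NumberTheory.QuadraticFields.GaussianDigits

open _root_.Zsqrtd

/-! ## §1 Digits, digit sets, widths, octagons -/

/-- Graves' digit set `B₀ = {0, ±1, ±i}` (the zero and the four units of `ℤ[i]`). [cite: Graves2023, Def. 2.1 (p. 3)] -/
def digits : Set (ℤ√(-1)) := {0, 1, -1, ⟨0, 1⟩, ⟨0, -1⟩}

/-- **`B_n`**: the Gaussian integers with an `(1+i)`-ary expansion `Σ_{j=0}^n v_j (1+i)^j` with `n+1` digits
`v_j ∈ {0, ±1, ±i}`, defined by the bottom-digit recursion `B_{n+1} = B₀ + (1+i) B_n` (equivalence with the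
printed form: `mem_digitSet_iff_exists_sum`). [cite: Graves2023, Def. 2.1 (p. 3)] -/
def digitSet : ℕ → Set (ℤ√(-1))
  | 0 => digits
  | n + 1 => {z | ∃ v ∈ digits, ∃ y ∈ digitSet n, z = v + ⟨1, 1⟩ * y}

/-- **`w_n`**: `w_{2m} = 2^{m+1} + 2^m = 3·2^m`, `w_{2m+1} = 2^{m+2} = 4·2^m`; equivalently `w₀ = 3`, `w₁ = 4`,
`w_{k+2} = 2 w_k` (closed forms: `width_two_mul`, `width_two_mul_add_one`). [cite: Graves2023, Def. 2.3 (p. 3)] -/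
def width : ℕ → ℤ
  | 0 => 3
  | 1 => 4
  | n + 2 => 2 * width n

/-- **`Oct_n`** `= {x+yi : |x|, |y| ≤ w_n − 2, |x|+|y| ≤ w_{n+1} − 3}`. [cite: Graves2023, Def. 2.4 (p. 3)] -/
def octagon (n : ℕ) : Set (ℤ√(-1)) :=
  {z | |z.re| ≤ width n - 2 ∧ |z.im| ≤ width n - 2 ∧ |z.re| + |z.im| ≤ width (n + 1) - 3}

/-! ### Digits -/

/-- The five digits, listed. [cite: Graves2023, Def. 2.1 (p. 3)] -/
theorem mem_digits_iff {v : ℤ√(-1)} : v ∈ digits ↔ v = 0 ∨ v = 1 ∨ v = -1 ∨ v = ⟨0, 1⟩ ∨ v = ⟨0, -1⟩ := by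
  simp only [digits, Set.mem_insert_iff, Set.mem_singleton_iff]

/-- A Gaussian integer is a digit iff `|re| + |im| ≤ 1`. [cite: Graves2023, Def. 2.1 (p. 3)] -/
theorem mem_digits_iff_natAbs {v : ℤ√(-1)} : v ∈ digits ↔ v.re.natAbs + v.im.natAbs ≤ 1 := by
  rw [mem_digits_iff]
  obtain ⟨x, y⟩ := v
  simp only [Zsqrtd.ext_iff, re_zero, im_zero, re_one, im_one, re_neg, im_neg, neg_zero]
  omega

/-- `0` is a digit. [cite: Graves2023, Def. 2.1 (p. 3)] -/
theorem zero_mem_digits : (0 : ℤ√(-1)) ∈ digits := mem_digits_iff.mpr (Or.inl rfl)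

/-- `1` is a digit. [cite: Graves2023, Def. 2.1 (p. 3)] -/
theorem one_mem_digits : (1 : ℤ√(-1)) ∈ digits := mem_digits_iff.mpr (Or.inr (Or.inl rfl))

/-- `i` is a digit. [cite: Graves2023, Def. 2.1 (p. 3)] -/
theorem i_mem_digits : (⟨0, 1⟩ : ℤ√(-1)) ∈ digits := mem_digits_iff_natAbs.mpr (by decide)

/-- `−i` is a digit. [cite: Graves2023, Def. 2.1 (p. 3)] -/
theorem negI_mem_digits : (⟨0, -1⟩ : ℤ√(-1)) ∈ digits := mem_digits_iff_natAbs.mpr (by decide)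

/-- «`2 ∤ (x, y)`» in the form `omega` uses: one coordinate is odd. [cite: Graves2023, Cor. 2.6 (p. 4)] -/
theorem emod_two_eq_one_or_of_not_two_dvd {x y : ℤ} (h : ¬(2 ∣ x ∧ 2 ∣ y)) : x % 2 = 1 ∨ y % 2 = 1 := by
  rcases Int.emod_two_eq_zero_or_one x with hx | hx
  · rcases Int.emod_two_eq_zero_or_one y with hy | hy
    · exact absurd ⟨Int.dvd_of_emod_eq_zero hx, Int.dvd_of_emod_eq_zero hy⟩ h
    · exact Or.inr hy
  · exact Or.inl hx

/-- The digits are closed under negation. [cite: Graves2023, Def. 2.1 (p. 3)] -/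
theorem neg_mem_digits {v : ℤ√(-1)} (hv : v ∈ digits) : -v ∈ digits := by
  rw [mem_digits_iff_natAbs] at hv ⊢
  simpa using hv

/-- The digits are closed under multiplication by `i`. [cite: Graves2023, Def. 2.1 (p. 3)] -/
theorem i_mul_mem_digits {v : ℤ√(-1)} (hv : v ∈ digits) : ⟨0, 1⟩ * v ∈ digits := by
  rw [mem_digits_iff_natAbs] at hv ⊢
  simp only [re_mul, im_mul]
  omega

/-- The digits are closed under conjugation. [cite: Graves2023, Def. 2.1 (p. 3)] -/
theorem star_mem_digits {v : ℤ√(-1)} (hv : v ∈ digits) : star v ∈ digits := by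
  rw [mem_digits_iff_natAbs] at hv ⊢
  obtain ⟨x, y⟩ := v
  simpa [star_mk] using hv

/-- A digit divisible by `1+i` (i.e. with `re + im` even) is `0`. [cite: Graves2023, Lemma 2.2 (proof, p. 3)] -/
theorem eq_zero_of_mem_digits_of_two_dvd {v : ℤ√(-1)} (hv : v ∈ digits) (h : 2 ∣ v.re + v.im) : v = 0 := by
  rw [mem_digits_iff_natAbs] at hv
  exact Zsqrtd.ext (by simp; omega) (by simp; omega)

/-! ### Divisibility by `1+i` and by `2` in coordinates -/

/-- `(1+i) ∣ x+yi ↔ 2 ∣ x+y`. [cite: Graves2023, §2 (p. 2)] -/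
theorem oneAddI_dvd_iff {z : ℤ√(-1)} : (⟨1, 1⟩ : ℤ√(-1)) ∣ z ↔ 2 ∣ z.re + z.im := by
  constructor
  · rintro ⟨w, rfl⟩
    exact ⟨w.re, by simp only [re_mul, im_mul]; ring⟩
  · intro h
    refine ⟨⟨(z.re + z.im) / 2, (z.im - z.re) / 2⟩, Zsqrtd.ext ?_ ?_⟩
    · simp only [re_mul]; omega
    · simp only [im_mul]; omega

/-- `2 ∣ x+yi ↔ 2 ∣ x ∧ 2 ∣ y`. [cite: Graves2023, §2 (p. 3)] -/
theorem two_dvd_iff {z : ℤ√(-1)} : (2 : ℤ√(-1)) ∣ z ↔ 2 ∣ z.re ∧ 2 ∣ z.im := by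
  rw [show (2 : ℤ√(-1)) = ((2 : ℤ) : ℤ√(-1)) by rfl]
  exact intCast_dvd 2 z

/-- `2 = −i·(1+i)²` in `ℤ[i]`. [cite: Graves2023, §1 (p. 2)] -/
theorem two_eq : (2 : ℤ√(-1)) = ⟨0, -1⟩ * (⟨1, 1⟩ * ⟨1, 1⟩) := by decide

/-! ### Widths -/

/-- `w₀ = 3`. [cite: Graves2023, Def. 2.3 (p. 3)] -/
@[simp] theorem width_zero : width 0 = 3 := rfl

/-- `w₁ = 4`. [cite: Graves2023, Def. 2.3 (p. 3)] -/
@[simp] theorem width_one : width 1 = 4 := rfl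

/-- `w_{k+2} = 2 w_k`. [cite: Graves2023, Def. 2.3 (p. 3)] -/
theorem width_add_two (n : ℕ) : width (n + 2) = 2 * width n := rfl

/-- Closed form `w_{2m} = 3·2^m` (`= 2^{m+1} + 2^m`). [cite: Graves2023, Def. 2.3 (p. 3)] -/
theorem width_two_mul (m : ℕ) : width (2 * m) = 3 * 2 ^ m := by
  induction m with
  | zero => rfl
  | succ m ih => rw [show 2 * (m + 1) = 2 * m + 2 by ring, width_add_two, ih, pow_succ]; ring

/-- Closed form `w_{2m+1} = 4·2^m` (`= 2^{m+2}`). [cite: Graves2023, Def. 2.3 (p. 3)] -/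
theorem width_two_mul_add_one (m : ℕ) : width (2 * m + 1) = 4 * 2 ^ m := by
  induction m with
  | zero => rfl
  | succ m ih => rw [show 2 * (m + 1) + 1 = (2 * m + 1) + 2 by ring, width_add_two, ih, pow_succ]; ring

/-- `w_{m+2j} = 2^j w_m` («if `2^j` divides both `a` and `b` […] then `a/2^j + (b/2^j)i ∈ B_{n−2j}`»).
[cite: Graves2023, §2 (p. 3)] -/
theorem width_add_two_mul (m j : ℕ) : width (m + 2 * j) = 2 ^ j * width m := by
  induction j with
  | zero => simp
  | succ j ih => rw [show m + 2 * (j + 1) = (m + 2 * j) + 2 by ring, width_add_two, ih, pow_succ]; ring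

/-- `3 ≤ w_n`. [cite: Graves2023, Def. 2.3 (p. 3)] -/
theorem three_le_width (n : ℕ) : 3 ≤ width n := by
  induction n using Nat.twoStepInduction with
  | zero => simp
  | one => simp
  | more n ih _ => rw [width_add_two]; omega

/-- `w_n + 1 ≤ w_{n+1}`, indeed `w_{n+1} − w_n ∈ {2^{⌊n/2⌋}, 2^{⌊n/2⌋+1}}`; here the weak form.
[cite: Graves2023, Def. 2.3 (p. 3)] -/
theorem width_lt_width_succ (n : ℕ) : width n + 1 ≤ width (n + 1) := by
  induction n using Nat.twoStepInduction with
  | zero => simp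
  | one => simp [width_add_two]
  | more n ih _ => rw [width_add_two, width_add_two]; omega

/-- `2 (w_{n+1} − w_n) ≤ w_n` (printed list of properties of `w`). [cite: Graves2023, Def. 2.3 (p. 3)] -/
theorem two_mul_width_succ_sub_le (n : ℕ) : 2 * (width (n + 1) - width n) ≤ width n := by
  induction n using Nat.twoStepInduction with
  | zero => simp
  | one => simp [width_add_two]
  | more n ih _ =>
    have e1 : width (n + 2 + 1) = 2 * width (n + 1) := width_add_two (n + 1)
    have e2 : width (n + 2) = 2 * width n := width_add_two n
    omega

/-- `w_n` is even for `n ≥ 1`. [cite: Graves2023, Def. 2.3 (p. 3)] -/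
theorem two_dvd_width_succ (n : ℕ) : 2 ∣ width (n + 1) := by
  induction n using Nat.twoStepInduction with
  | zero => simp
  | one => simp [width_add_two]
  | more n ih _ => rw [width_add_two]; exact dvd_mul_right 2 _

/-- The shape of three consecutive widths: with `K = 2^{⌊n/2⌋}`, either `(w_n, w_{n+1}) = (3K, 4K)` (`n` even) or
`(4K, 6K)` (`n` odd); in both cases `w_{n+2} = 2 w_n`. [cite: Graves2023, Def. 2.3 (p. 3)] -/
theorem width_shape (n : ℕ) : ∃ K : ℤ, K = 2 ^ (n / 2) ∧
    ((width n = 3 * K ∧ width (n + 1) = 4 * K) ∨ (width n = 4 * K ∧ width (n + 1) = 6 * K)) := by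
  obtain ⟨m, rfl | rfl⟩ := Nat.even_or_odd' n
  · refine ⟨2 ^ m, by rw [Nat.mul_div_right m two_pos], Or.inl ⟨width_two_mul m, width_two_mul_add_one m⟩⟩
  · refine ⟨2 ^ m, by rw [Nat.mul_add_div two_pos, show 1 / 2 = 0 by rfl, add_zero], Or.inr ⟨?_, ?_⟩⟩
    · exact width_two_mul_add_one m
    · rw [show 2 * m + 1 + 1 = 2 * (m + 1) by ring, width_two_mul, pow_succ]; ring

/-! ### Octagons -/

/-- Membership in `Oct_n`, coordinates spelled with `natAbs`. [cite: Graves2023, Def. 2.4 (p. 3)] -/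
theorem mem_octagon_iff {n : ℕ} {z : ℤ√(-1)} : z ∈ octagon n ↔
    (z.re.natAbs : ℤ) ≤ width n - 2 ∧ (z.im.natAbs : ℤ) ≤ width n - 2 ∧
      (z.re.natAbs : ℤ) + z.im.natAbs ≤ width (n + 1) - 3 := by
  simp only [octagon, Set.mem_setOf_eq, Int.natCast_natAbs]

/-- `Oct_n = −Oct_n`. [cite: Graves2023, Def. 2.4 (p. 3)] -/
theorem neg_mem_octagon {n : ℕ} {z : ℤ√(-1)} (hz : z ∈ octagon n) : -z ∈ octagon n := by
  rw [mem_octagon_iff] at hz ⊢; simpa using hz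

/-- `Oct_n` is closed under conjugation. [cite: Graves2023, Def. 2.4 (p. 3)] -/
theorem star_mem_octagon {n : ℕ} {z : ℤ√(-1)} (hz : z ∈ octagon n) : star z ∈ octagon n := by
  rw [mem_octagon_iff] at hz ⊢; obtain ⟨x, y⟩ := z; simpa [star_mk] using hz

/-- `Oct_n` is closed under multiplication by `i`. [cite: Graves2023, Def. 2.4 (p. 3)] -/
theorem i_mul_mem_octagon {n : ℕ} {z : ℤ√(-1)} (hz : z ∈ octagon n) : ⟨0, 1⟩ * z ∈ octagon n := by
  rw [mem_octagon_iff] at hz ⊢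
  simp only [re_mul, im_mul]
  omega

/-- `Oct_n ⊆ Oct_{n+1}`. [cite: Graves2023, Def. 2.4 (p. 3)] -/
theorem octagon_mono (n : ℕ) : octagon n ⊆ octagon (n + 1) := by
  intro z hz
  rw [mem_octagon_iff] at hz ⊢
  have h1 := width_lt_width_succ n
  have h2 := width_lt_width_succ (n + 1)
  omega

/-! ## §2 Structure of the digit sets -/

/-- `B₀` is the digit set. [cite: Graves2023, Def. 2.1 (p. 3)] -/
@[simp] theorem digitSet_zero : digitSet 0 = digits := rfl

/-- The bottom-digit recursion `B_{n+1} = B₀ + (1+i) B_n`. [cite: Graves2023, Def. 2.1 (p. 3)] -/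
theorem mem_digitSet_succ {n : ℕ} {z : ℤ√(-1)} :
    z ∈ digitSet (n + 1) ↔ ∃ v ∈ digits, ∃ y ∈ digitSet n, z = v + ⟨1, 1⟩ * y := Iff.rfl

/-- Constructor for the recursion. [cite: Graves2023, Def. 2.1 (p. 3)] -/
theorem add_mul_mem_digitSet_succ {n : ℕ} {v y : ℤ√(-1)} (hv : v ∈ digits) (hy : y ∈ digitSet n) :
    v + ⟨1, 1⟩ * y ∈ digitSet (n + 1) := ⟨v, hv, y, hy, rfl⟩

/-- `0 ∈ B_n`. [cite: Graves2023, Def. 2.1 (p. 3)] -/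
theorem zero_mem_digitSet (n : ℕ) : (0 : ℤ√(-1)) ∈ digitSet n := by
  induction n with
  | zero => exact zero_mem_digits
  | succ n ih => exact ⟨0, zero_mem_digits, 0, ih, by simp⟩

/-- `B₀ ⊆ B_n`. [cite: Graves2023, Def. 2.1 (p. 3)] -/
theorem digits_subset_digitSet (n : ℕ) : digits ⊆ digitSet n := by
  cases n with
  | zero => exact le_rfl
  | succ n => exact fun v hv ↦ ⟨v, hv, 0, zero_mem_digitSet n, by simp⟩

/-- `(1+i) B_n ⊆ B_{n+1}` («If `a+bi ∈ B_n`, then `(1+i)^j (a+bi) ∈ B_{n+j}`», `j = 1`). [cite: Graves2023, §2 (p. 3)] -/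
theorem oneAddI_mul_mem_digitSet_succ {n : ℕ} {y : ℤ√(-1)} (hy : y ∈ digitSet n) :
    ⟨1, 1⟩ * y ∈ digitSet (n + 1) := ⟨0, zero_mem_digits, y, hy, by simp⟩

/-- `B_n ⊆ B_{n+1}`. [cite: Graves2023, Def. 2.1 (p. 3)] -/
theorem digitSet_subset_succ (n : ℕ) : digitSet n ⊆ digitSet (n + 1) := by
  induction n with
  | zero => exact digits_subset_digitSet 1
  | succ n ih =>
    rintro z ⟨v, hv, y, hy, rfl⟩
    exact ⟨v, hv, y, ih hy, rfl⟩

/-- `B_m ⊆ B_n` for `m ≤ n`. [cite: Graves2023, Def. 2.1 (p. 3)] -/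
theorem digitSet_mono {m n : ℕ} (h : m ≤ n) : digitSet m ⊆ digitSet n := by
  induction h with
  | refl => exact le_rfl
  | step _ ih => exact ih.trans (digitSet_subset_succ _)

/-- `(1+i)^j B_n ⊆ B_{n+j}`. [cite: Graves2023, §2 (p. 3)] -/
theorem pow_mul_mem_digitSet {n : ℕ} {y : ℤ√(-1)} (hy : y ∈ digitSet n) (j : ℕ) :
    ⟨1, 1⟩ ^ j * y ∈ digitSet (n + j) := by
  induction j with
  | zero => simpa using hy
  | succ j ih => rw [pow_succ', mul_assoc]; exact oneAddI_mul_mem_digitSet_succ ih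

/-- `B_n` is closed under multiplication by `i`. [cite: Graves2023, §2 (p. 3)] -/
theorem i_mul_mem_digitSet {n : ℕ} {z : ℤ√(-1)} (hz : z ∈ digitSet n) : ⟨0, 1⟩ * z ∈ digitSet n := by
  induction n generalizing z with
  | zero => exact i_mul_mem_digits hz
  | succ n ih =>
    obtain ⟨v, hv, y, hy, rfl⟩ := hz
    exact ⟨_, i_mul_mem_digits hv, _, ih hy, by ring⟩

/-- `B_n = −B_n`. [cite: Graves2023, §2 (p. 3)] -/
theorem neg_mem_digitSet {n : ℕ} {z : ℤ√(-1)} (hz : z ∈ digitSet n) : -z ∈ digitSet n := by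
  have h := i_mul_mem_digitSet (i_mul_mem_digitSet hz)
  rw [← mul_assoc, show (⟨0, 1⟩ * ⟨0, 1⟩ : ℤ√(-1)) = -1 by decide, neg_one_mul] at h
  exact h

/-- `B_n` is closed under multiplication by `−i`. [cite: Graves2023, §2 (p. 3)] -/
theorem negI_mul_mem_digitSet {n : ℕ} {z : ℤ√(-1)} (hz : z ∈ digitSet n) : ⟨0, -1⟩ * z ∈ digitSet n := by
  have h := neg_mem_digitSet (i_mul_mem_digitSet hz)
  rw [← neg_mul, show (-⟨0, 1⟩ : ℤ√(-1)) = ⟨0, -1⟩ by decide] at h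
  exact h

/-- `B_n` is closed under multiplication by units (the elements `u` with `|re u| + |im u| = 1`) and, more
generally, by digits. [cite: Graves2023, §2 (p. 3)] -/
theorem digit_mul_mem_digitSet {n : ℕ} {u z : ℤ√(-1)} (hu : u ∈ digits) (hz : z ∈ digitSet n) :
    u * z ∈ digitSet n := by
  rcases mem_digits_iff.mp hu with rfl | rfl | rfl | rfl | rfl
  · simpa using zero_mem_digitSet n
  · simpa using hz
  · simpa using neg_mem_digitSet hz
  · exact i_mul_mem_digitSet hz
  · exact negI_mul_mem_digitSet hz

/-- `B_n` is closed under complex conjugation. [cite: Graves2023, §2 (p. 3)] -/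
theorem star_mem_digitSet {n : ℕ} {z : ℤ√(-1)} (hz : z ∈ digitSet n) : star z ∈ digitSet n := by
  induction n generalizing z with
  | zero => exact star_mem_digits hz
  | succ n ih =>
    obtain ⟨v, hv, y, hy, rfl⟩ := hz
    refine ⟨star v, star_mem_digits hv, ⟨0, -1⟩ * star y, negI_mul_mem_digitSet (ih hy), ?_⟩
    rw [star_add, star_mul, ← mul_assoc, show (star ⟨1, 1⟩ : ℤ√(-1)) = ⟨1, 1⟩ * ⟨0, -1⟩ by decide,
      mul_comm (star y)]

/-- The top-digit recursion: `B_n + v (1+i)^{n+1} ⊆ B_{n+1}` for a digit `v`. [cite: Graves2023, Thm. 2.5 (proof, p. 3)] -/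
theorem add_mul_pow_mem_digitSet {n : ℕ} {v y : ℤ√(-1)} (hv : v ∈ digits) (hy : y ∈ digitSet n) :
    y + v * ⟨1, 1⟩ ^ (n + 1) ∈ digitSet (n + 1) := by
  induction n generalizing y with
  | zero =>
    rw [zero_add, pow_one, mul_comm v]
    exact add_mul_mem_digitSet_succ (digitSet_zero ▸ hy) (digits_subset_digitSet 0 hv)
  | succ n ih =>
    obtain ⟨v₀, hv₀, c, hc, rfl⟩ := mem_digitSet_succ.mp hy
    exact mem_digitSet_succ.mpr ⟨v₀, hv₀, c + v * (⟨1, 1⟩ : ℤ√(-1)) ^ (n + 1), ih hc, by ring⟩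

/-- **Definition 2.1 as printed**: `z ∈ B_n` iff `z = Σ_{j=0}^n v_j (1+i)^j` with digits `v_j`.
[cite: Graves2023, Def. 2.1 (p. 3)] -/
theorem mem_digitSet_iff_exists_sum {n : ℕ} {z : ℤ√(-1)} : z ∈ digitSet n ↔
    ∃ v : ℕ → ℤ√(-1), (∀ j ≤ n, v j ∈ digits) ∧ z = ∑ j ∈ Finset.range (n + 1), v j * ⟨1, 1⟩ ^ j := by
  induction n generalizing z with
  | zero =>
    simp only [zero_add, Finset.sum_range_one, pow_zero, mul_one, Nat.le_zero, forall_eq, digitSet_zero]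
    exact ⟨fun hz ↦ ⟨fun _ ↦ z, hz, rfl⟩, fun ⟨v, hv, h⟩ ↦ h ▸ hv⟩
  | succ n ih =>
    constructor
    · rintro ⟨v₀, hv₀, y, hy, rfl⟩
      obtain ⟨v, hv, rfl⟩ := ih.mp hy
      refine ⟨fun j ↦ if j = 0 then v₀ else v (j - 1), fun j hj ↦ ?_, ?_⟩
      · by_cases hj0 : j = 0
        · dsimp only; rw [if_pos hj0]; exact hv₀
        · dsimp only; rw [if_neg hj0]; exact hv (j - 1) (by omega)
      · rw [Finset.sum_range_succ' (fun j ↦ (if j = 0 then v₀ else v (j - 1)) * ⟨1, 1⟩ ^ j) (n + 1)]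
        simp only [Nat.add_one_ne_zero, if_false, Nat.add_sub_cancel, if_true, pow_zero, mul_one, pow_succ,
          Finset.mul_sum]
        rw [add_comm]
        congr 1
        exact Finset.sum_congr rfl fun j _ ↦ by ring
    · rintro ⟨v, hv, rfl⟩
      refine ⟨v 0, hv 0 (Nat.zero_le _), ∑ j ∈ Finset.range (n + 1), v (j + 1) * ⟨1, 1⟩ ^ j,
        ih.mpr ⟨fun j ↦ v (j + 1), fun j hj ↦ hv (j + 1) (by omega), rfl⟩, ?_⟩
      rw [Finset.sum_range_succ' (fun j ↦ v j * ⟨1, 1⟩ ^ j) (n + 1)]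
      simp only [pow_zero, mul_one, pow_succ, Finset.mul_sum]
      rw [add_comm]
      congr 1
      exact Finset.sum_congr rfl fun j _ ↦ by ring

/-! ### Stripping the bottom digit -/

/-- If `(1+i) y ∈ B_{n+1}` then `y ∈ B_n` (the bottom digit of a multiple of `1+i` is `0`).
[cite: Graves2023, Lemma 2.2 (proof, p. 3)] -/
theorem mem_digitSet_of_oneAddI_mul_mem {n : ℕ} {y : ℤ√(-1)} (h : ⟨1, 1⟩ * y ∈ digitSet (n + 1)) :
    y ∈ digitSet n := by
  obtain ⟨v, hv, c, hc, h⟩ := h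
  have hv0 : v = 0 := by
    refine eq_zero_of_mem_digits_of_two_dvd hv ?_
    have h1 := congrArg Zsqrtd.re h
    have h2 := congrArg Zsqrtd.im h
    simp only [re_add, re_mul, im_add, im_mul] at h1 h2
    exact ⟨y.re - c.re, by linarith⟩
  rw [hv0, zero_add] at h
  rwa [mul_left_cancel₀ (by decide : (⟨1, 1⟩ : ℤ√(-1)) ≠ 0) h]

/-- If `(1+i) y ∈ B₀` then `y = 0`. [cite: Graves2023, Lemma 2.2 (proof, p. 3)] -/
theorem eq_zero_of_oneAddI_mul_mem_digits {y : ℤ√(-1)} (h : ⟨1, 1⟩ * y ∈ digits) : y = 0 := by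
  have h0 : (⟨1, 1⟩ : ℤ√(-1)) * y = 0 :=
    eq_zero_of_mem_digits_of_two_dvd h ⟨y.re, by simp only [re_mul, im_mul]; ring⟩
  exact (mul_eq_zero.mp h0).resolve_left (by decide)

/-- **Lemma 2.2**: «If `x ∈ B_k` and `(1+i)^{k+1} ∣ x`, then `x = 0`.» [cite: Graves2023, Lemma 2.2 (p. 3)] -/
theorem eq_zero_of_pow_dvd_of_mem_digitSet {k : ℕ} {x : ℤ√(-1)} (hx : x ∈ digitSet k)
    (hdvd : (⟨1, 1⟩ : ℤ√(-1)) ^ (k + 1) ∣ x) : x = 0 := by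
  induction k generalizing x with
  | zero =>
    obtain ⟨w, rfl⟩ := hdvd
    rw [zero_add, pow_one] at hx ⊢
    rw [eq_zero_of_oneAddI_mul_mem_digits hx, mul_zero]
  | succ k ih =>
    obtain ⟨w, rfl⟩ := hdvd
    have h1 : (⟨1, 1⟩ : ℤ√(-1)) * (⟨1, 1⟩ ^ (k + 1) * w) ∈ digitSet (k + 1) := by
      rw [← mul_assoc, ← pow_succ']; exact hx
    have h2 := ih (mem_digitSet_of_oneAddI_mul_mem h1) (dvd_mul_right _ _)
    rw [pow_succ', mul_assoc, h2, mul_zero]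

/-- `(1+i)^{n+1} ∉ B_n`. [cite: Graves2023, Lemma 2.2 (p. 3)] -/
theorem pow_not_mem_digitSet (n : ℕ) : (⟨1, 1⟩ : ℤ√(-1)) ^ (n + 1) ∉ digitSet n := fun h ↦
  pow_ne_zero (n + 1) (by decide : (⟨1, 1⟩ : ℤ√(-1)) ≠ 0) (eq_zero_of_pow_dvd_of_mem_digitSet h dvd_rfl)

/-- For `(1+i) ∣ z`: `z ∈ B_{n+1} ↔ z/(1+i) ∈ B_n`. [cite: Graves2023, §2 (p. 3)] -/
theorem oneAddI_mul_mem_digitSet_succ_iff {n : ℕ} {y : ℤ√(-1)} :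
    ⟨1, 1⟩ * y ∈ digitSet (n + 1) ↔ y ∈ digitSet n :=
  ⟨mem_digitSet_of_oneAddI_mul_mem, oneAddI_mul_mem_digitSet_succ⟩

/-- **Doubling**: `2z ∈ B_{n+2} ↔ z ∈ B_n` (`2 = −i(1+i)²`). [cite: Graves2023, §2 (p. 3)] -/
theorem two_mul_mem_digitSet_iff {n : ℕ} {y : ℤ√(-1)} : 2 * y ∈ digitSet (n + 2) ↔ y ∈ digitSet n := by
  rw [two_eq, mul_comm (⟨0, -1⟩ : ℤ√(-1)), mul_assoc, mul_assoc, oneAddI_mul_mem_digitSet_succ_iff,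
    oneAddI_mul_mem_digitSet_succ_iff]
  refine ⟨fun h ↦ ?_, negI_mul_mem_digitSet⟩
  have h' := i_mul_mem_digitSet h
  rwa [← mul_assoc, show (⟨0, 1⟩ * ⟨0, -1⟩ : ℤ√(-1)) = 1 by decide, one_mul] at h'

/-- `2z ∉ B₁` for `z ≠ 0`. [cite: Graves2023, Lemma 2.2 (p. 3)] -/
theorem two_mul_not_mem_digitSet_one {y : ℤ√(-1)} (hy : y ≠ 0) : 2 * y ∉ digitSet 1 := by
  intro h
  rw [two_eq, mul_comm (⟨0, -1⟩ : ℤ√(-1)), mul_assoc, mul_assoc, oneAddI_mul_mem_digitSet_succ_iff,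
    digitSet_zero] at h
  exact hy ((mul_eq_zero.mp (eq_zero_of_oneAddI_mul_mem_digits h)).resolve_left (by decide))

/-- `2z ∉ B₀` for `z ≠ 0`. [cite: Graves2023, Lemma 2.2 (p. 3)] -/
theorem two_mul_not_mem_digitSet_zero {y : ℤ√(-1)} (hy : y ≠ 0) : 2 * y ∉ digitSet 0 := fun h ↦
  two_mul_not_mem_digitSet_one hy (digitSet_subset_succ 0 h)

/-- `2^j z ∈ B_{m+2j} ↔ z ∈ B_m`. [cite: Graves2023, §2 (p. 3)] -/
theorem two_pow_mul_mem_digitSet_iff {m j : ℕ} {y : ℤ√(-1)} :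
    2 ^ j * y ∈ digitSet (m + 2 * j) ↔ y ∈ digitSet m := by
  induction j with
  | zero => simp
  | succ j ih => rw [show m + 2 * (j + 1) = (m + 2 * j) + 2 by ring, pow_succ', mul_assoc,
      two_mul_mem_digitSet_iff, ih]

/-- `2^j z ∉ B_m` for `z ≠ 0` and `m < 2j`. [cite: Graves2023, §2 (p. 3)] -/
theorem two_pow_mul_not_mem_digitSet {m j : ℕ} {y : ℤ√(-1)} (hy : y ≠ 0) (hm : m < 2 * j) :
    2 ^ j * y ∉ digitSet m := by
  induction j generalizing m with
  | zero => omega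
  | succ j ih =>
    intro h
    rcases Nat.lt_or_ge m 2 with hm2 | hm2
    · have h2 : (2 : ℤ√(-1)) * (2 ^ j * y) ∈ digitSet m := by rwa [← mul_assoc, ← pow_succ']
      interval_cases m
      · exact two_mul_not_mem_digitSet_zero (mul_ne_zero (pow_ne_zero _ two_ne_zero) hy) h2
      · exact two_mul_not_mem_digitSet_one (mul_ne_zero (pow_ne_zero _ two_ne_zero) hy) h2
    · obtain ⟨m, rfl⟩ := Nat.exists_eq_add_of_le' hm2
      rw [pow_succ', mul_assoc, two_mul_mem_digitSet_iff] at h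
      exact ih (by omega) h

/-! ## §3 `B_n ⊆ Oct_n`, and the elements of `Oct_n` prime to `2` lie in `B_n` -/

/-- **`B_n ⊆ Oct_n`** (Corollary 2.6, first inclusion). [cite: Graves2023, Cor. 2.6 (p. 4)] -/
theorem digitSet_subset_octagon (n : ℕ) : digitSet n ⊆ octagon n := by
  induction n with
  | zero =>
    intro z hz
    rw [digitSet_zero, mem_digits_iff_natAbs] at hz
    rw [mem_octagon_iff, width_zero, width_one]
    omega
  | succ n ih =>
    rintro z ⟨v, hv, y, hy, rfl⟩
    have hy' := mem_octagon_iff.mp (ih hy)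
    rw [mem_digits_iff_natAbs] at hv
    rw [mem_octagon_iff, width_add_two]
    have h3 := three_le_width n
    have hw := width_lt_width_succ n
    simp only [re_add, im_add, re_mul, im_mul]
    omega

/-- `B_n ⊆ Oct_n`, pointwise. [cite: Graves2023, Cor. 2.6 (p. 4)] -/
theorem mem_octagon_of_mem_digitSet {n : ℕ} {z : ℤ√(-1)} (hz : z ∈ digitSet n) : z ∈ octagon n :=
  digitSet_subset_octagon n hz

/-- Stripping a bottom digit inside the octagon: if `z − v` is divisible by `1+i` and small, the quotient
`c = (z − v)/(1+i)` lies in `Oct_n` (and `z = v + (1+i)c`). [cite: Graves2023, Cor. 2.6 (p. 4)] -/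
private theorem exists_quotient {n : ℕ} (X Y : ℤ) (hXY : (X + Y) % 2 = 0)
    (h1 : (X.natAbs : ℤ) ≤ width (n + 1) - 3) (h2 : (Y.natAbs : ℤ) ≤ width (n + 1) - 3)
    (h3 : (X.natAbs : ℤ) + Y.natAbs ≤ 2 * width n - 4) :
    ∃ c : ℤ√(-1), c ∈ octagon n ∧ (⟨X, Y⟩ : ℤ√(-1)) = ⟨1, 1⟩ * c ∧ c.re + c.im = Y := by
  refine ⟨⟨(X + Y) / 2, (Y - X) / 2⟩, ?_, Zsqrtd.ext ?_ ?_, ?_⟩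
  · rw [mem_octagon_iff]; dsimp only; omega
  · simp only [re_mul]; omega
  · simp only [im_mul]; omega
  · dsimp only; omega

/-- **The Gaussian integers of `Oct_n` prime to `2` lie in `B_n`**: «If `a+bi ∈ Oct_n`, `2 ∤ (a,b)`, then
`a+bi ∈ B_n`» (Corollary 2.6, last sentence; here proved directly by induction on `n`, stripping bottom
digits, and used below to derive Theorem 2.5). [cite: Graves2023, Cor. 2.6 (p. 4)] -/
theorem mem_digitSet_of_not_two_dvd {n : ℕ} {z : ℤ√(-1)} (hodd : ¬(2 ∣ z.re ∧ 2 ∣ z.im))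
    (hz : z ∈ octagon n) : z ∈ digitSet n := by
  induction n generalizing z with
  | zero =>
    rw [mem_octagon_iff, width_zero, width_one] at hz
    rw [digitSet_zero, mem_digits_iff_natAbs]
    omega
  | succ n ih =>
    have hz' := mem_octagon_iff.mp hz
    have h3 := three_le_width n
    have hw := width_lt_width_succ n
    have hw2 := width_lt_width_succ (n + 1)
    have hw' := two_mul_width_succ_sub_le (n + 1)
    have he := two_dvd_width_succ n
    have e2 : width (n + 1 + 1) = 2 * width n := width_add_two n
    obtain ⟨x, y⟩ := z
    dsimp only at hodd hz' ⊢
    have hpar := emod_two_eq_one_or_of_not_two_dvd hodd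
    rcases Int.emod_two_eq_zero_or_one (x + y) with hxy | hxy
    · -- `x`, `y` both odd: `z = (1+i) w` with `w ∈ Oct_n` primitive
      obtain ⟨c, hc, hzc, hcY⟩ := exists_quotient (n := n) x y hxy (by omega) (by omega) (by omega)
      rw [hzc]
      exact oneAddI_mul_mem_digitSet_succ (ih (fun ⟨hc1, hc2⟩ ↦ by omega) hc)
    · -- `x + y` odd: subtract a unit `v` with `(z − v)/(1+i)` primitive and in `Oct_n`
      obtain ⟨v, hv, X, Y, hXY, hvz, h1, h2, h3', hY⟩ : ∃ v ∈ digits, ∃ X Y : ℤ, (X + Y) % 2 = 0 ∧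
          (⟨x, y⟩ : ℤ√(-1)) = v + ⟨X, Y⟩ ∧ (X.natAbs : ℤ) ≤ width (n + 1) - 3 ∧
          (Y.natAbs : ℤ) ≤ width (n + 1) - 3 ∧ (X.natAbs : ℤ) + Y.natAbs ≤ 2 * width n - 4 ∧
          Y % 2 = 1 := by
        rcases Int.emod_two_eq_zero_or_one y with hy2 | hy2
        · by_cases hy : 1 ≤ y
          · exact ⟨⟨0, 1⟩, i_mem_digits, x, y - 1, by omega, Zsqrtd.ext (by simp) (by simp), by omega,
              by omega, by omega, by omega⟩
          · exact ⟨⟨0, -1⟩, negI_mem_digits, x, y + 1, by omega, Zsqrtd.ext (by simp) (by simp), by omega,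
              by omega, by omega, by omega⟩
        · by_cases hx : 1 ≤ x
          · exact ⟨1, one_mem_digits, x - 1, y, by omega, Zsqrtd.ext (by simp) (by simp), by omega,
              by omega, by omega, by omega⟩
          · exact ⟨-1, neg_mem_digits one_mem_digits, x + 1, y, by omega, Zsqrtd.ext (by simp) (by simp),
              by omega, by omega, by omega, by omega⟩
      obtain ⟨c, hc, hzc, hcY⟩ := exists_quotient (n := n) X Y hXY h1 h2 h3'
      rw [hvz, hzc]
      exact add_mul_mem_digitSet_succ hv (ih (fun ⟨hc1, hc2⟩ ↦ by omega) hc)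

/-- The units of `Oct_{n+1}`… more precisely: an element of `Oct_n` prime to `2` is in `B_n`, and conversely
`B_n ⊆ Oct_n`; so for `z` prime to `2`, `z ∈ B_n ↔ z ∈ Oct_n`. [cite: Graves2023, Cor. 2.6 (p. 4)] -/
theorem mem_digitSet_iff_mem_octagon_of_not_two_dvd {n : ℕ} {z : ℤ√(-1)} (hodd : ¬(2 ∣ z.re ∧ 2 ∣ z.im)) :
    z ∈ digitSet n ↔ z ∈ octagon n :=
  ⟨mem_octagon_of_mem_digitSet, mem_digitSet_of_not_two_dvd hodd⟩

/-! ## §4 Theorem 2.5: the explicit description of `B_n` -/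

/-- Every pair `(x, y) ≠ (0, 0)` has an exact power of two: `2^k ∥ (x, y)`. [cite: Graves2023, Thm. 2.5 (p. 3)] -/
theorem exists_exact_two_pow {x y : ℤ} (h : ¬(x = 0 ∧ y = 0)) :
    ∃ k : ℕ, ((2 : ℤ) ^ k ∣ x ∧ (2 : ℤ) ^ k ∣ y) ∧ ¬((2 : ℤ) ^ (k + 1) ∣ x ∧ (2 : ℤ) ^ (k + 1) ∣ y) := by
  suffices H : ∀ N : ℕ, ∀ x y : ℤ, x.natAbs + y.natAbs ≤ N → ¬(x = 0 ∧ y = 0) →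
      ∃ k : ℕ, ((2 : ℤ) ^ k ∣ x ∧ (2 : ℤ) ^ k ∣ y) ∧ ¬((2 : ℤ) ^ (k + 1) ∣ x ∧ (2 : ℤ) ^ (k + 1) ∣ y) from
    H _ x y le_rfl h
  intro N
  induction N with
  | zero => intro x y hN h; exact absurd ⟨by omega, by omega⟩ h
  | succ N ih =>
    intro x y hN h
    by_cases h2 : 2 ∣ x ∧ 2 ∣ y
    · obtain ⟨⟨x', rfl⟩, ⟨y', rfl⟩⟩ := h2
      obtain ⟨k, ⟨hkx, hky⟩, hk⟩ := ih x' y' (by omega) (by omega)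
      refine ⟨k + 1, ⟨?_, ?_⟩, ?_⟩
      · rw [pow_succ']; exact mul_dvd_mul_left 2 hkx
      · rw [pow_succ']; exact mul_dvd_mul_left 2 hky
      · rintro ⟨h1, h2⟩
        rw [pow_succ' _ (k + 1)] at h1 h2
        exact hk ⟨(mul_dvd_mul_iff_left two_ne_zero).mp h1, (mul_dvd_mul_iff_left two_ne_zero).mp h2⟩
    · exact ⟨0, ⟨by simp, by simp⟩, by simpa using h2⟩

/-- The exact power of two of a pair is unique. [cite: Graves2023, Thm. 2.5 (p. 3)] -/
theorem exact_two_pow_unique {x y : ℤ} {j k : ℕ} (hj : (2 : ℤ) ^ j ∣ x ∧ (2 : ℤ) ^ j ∣ y)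
    (hj' : ¬((2 : ℤ) ^ (j + 1) ∣ x ∧ (2 : ℤ) ^ (j + 1) ∣ y)) (hk : (2 : ℤ) ^ k ∣ x ∧ (2 : ℤ) ^ k ∣ y)
    (hk' : ¬((2 : ℤ) ^ (k + 1) ∣ x ∧ (2 : ℤ) ^ (k + 1) ∣ y)) : j = k := by
  by_contra hne
  rcases Nat.lt_or_gt_of_ne hne with h | h
  · have hd : (2 : ℤ) ^ (j + 1) ∣ 2 ^ k := pow_dvd_pow 2 (by omega)
    exact hj' ⟨hd.trans hk.1, hd.trans hk.2⟩
  · have hd : (2 : ℤ) ^ (k + 1) ∣ 2 ^ j := pow_dvd_pow 2 (by omega)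
    exact hk' ⟨hd.trans hj.1, hd.trans hj.2⟩

/-- `w_n < 3·2^k` when `n < 2k` (so the `j`-th piece of Theorem 2.5 is empty for `2j > n`).
[cite: Graves2023, Thm. 2.5 (p. 3)] -/
theorem width_lt_of_lt_two_mul {n k : ℕ} (h : n < 2 * k) : width n < 3 * 2 ^ k := by
  have h2 : (0 : ℤ) < 2 ^ k := pow_pos two_pos k
  obtain ⟨m, rfl | rfl⟩ := Nat.even_or_odd' n
  · rw [width_two_mul]
    have : (2 : ℤ) ^ m < 2 ^ k := pow_lt_pow_right₀ (by norm_num) (by omega)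
    linarith
  · rw [width_two_mul_add_one]
    have : (2 : ℤ) ^ (m + 1) ≤ 2 ^ k := pow_le_pow_right₀ (by norm_num) (by omega)
    rw [pow_succ] at this
    linarith

/-- Cancelling a positive factor in an inequality of integers. [folklore] -/
private theorem scale_iff {P u v : ℤ} (hP : 0 < P) : P * u ≤ P * v ↔ u ≤ v :=
  ⟨fun h ↦ Int.le_of_mul_le_mul_left h hP, fun h ↦ Int.mul_le_mul_of_nonneg_left h hP.le⟩

/-- `2^k ∣ (x, y)` gives `z = 2^k z₀`. [cite: Graves2023, §2 (p. 3)] -/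
theorem eq_two_pow_mul {k : ℕ} {z : ℤ√(-1)} (h1 : (2 : ℤ) ^ k ∣ z.re) (h2 : (2 : ℤ) ^ k ∣ z.im) :
    ∃ z₀ : ℤ√(-1), z = 2 ^ k * z₀ ∧ z.re = 2 ^ k * z₀.re ∧ z.im = 2 ^ k * z₀.im := by
  obtain ⟨a, ha⟩ := h1
  obtain ⟨b, hb⟩ := h2
  refine ⟨⟨a, b⟩, ?_, ha, hb⟩
  rw [show (2 : ℤ√(-1)) ^ k = ((2 ^ k : ℤ) : ℤ√(-1)) by simp, smul_val]
  exact Zsqrtd.ext ha hb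

/-- For `z = 2^k z₀ ≠ 0` and `n < 2k` the `k`-th bounds fail (`3·2^k ≤ w_n` is impossible): the pieces
`j > ⌊n/2⌋` of Theorem 2.5 are empty. [cite: Graves2023, Thm. 2.5 (p. 3)] -/
private theorem not_bounds_of_lt {n k : ℕ} {z₀ : ℤ√(-1)} (hz₀ : z₀ ≠ 0) (hn : n < 2 * k)
    (h1 : (2 : ℤ) ^ k * (z₀.re.natAbs : ℤ) ≤ width n - 2 ^ (k + 1))
    (h2 : (2 : ℤ) ^ k * (z₀.im.natAbs : ℤ) ≤ width n - 2 ^ (k + 1)) : False := by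
  have hw := width_lt_of_lt_two_mul hn
  have hP : (0 : ℤ) < 2 ^ k := pow_pos two_pos k
  rw [pow_succ] at h1 h2
  rcases Nat.eq_zero_or_pos z₀.re.natAbs with h0 | hpos
  · have h1' : 1 ≤ (z₀.im.natAbs : ℤ) := by
      by_contra hlt
      exact hz₀ (Zsqrtd.ext (by simp; omega) (by simp; omega))
    have := Int.mul_le_mul_of_nonneg_left h1' hP.le
    linarith
  · have h1' : 1 ≤ (z₀.re.natAbs : ℤ) := by exact_mod_cast hpos
    have := Int.mul_le_mul_of_nonneg_left h1' hP.le
    linarith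

/-- **Theorem 2.5, exact-valuation form**: for `z ≠ 0` with `2^k ∥ (re z, im z)`,
`z ∈ B_n ↔ |re z|, |im z| ≤ w_n − 2^{k+1} ∧ |re z| + |im z| ≤ w_{n+1} − 3·2^k`. [cite: Graves2023, Thm. 2.5 (p. 3)] -/
theorem mem_digitSet_iff_of_exact {n k : ℕ} {z : ℤ√(-1)} (hz : z ≠ 0)
    (hk : (2 : ℤ) ^ k ∣ z.re ∧ (2 : ℤ) ^ k ∣ z.im) (hk' : ¬((2 : ℤ) ^ (k + 1) ∣ z.re ∧ (2 : ℤ) ^ (k + 1) ∣ z.im)) :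
    z ∈ digitSet n ↔ (z.re.natAbs : ℤ) ≤ width n - 2 ^ (k + 1) ∧ (z.im.natAbs : ℤ) ≤ width n - 2 ^ (k + 1) ∧
      (z.re.natAbs : ℤ) + z.im.natAbs ≤ width (n + 1) - 3 * 2 ^ k := by
  obtain ⟨z₀, hzz, hre, him⟩ := eq_two_pow_mul hk.1 hk.2
  have hP : (0 : ℤ) < 2 ^ k := pow_pos two_pos k
  have hz₀ : z₀ ≠ 0 := by rintro rfl; exact hz (by rw [hzz, mul_zero])
  have hodd : ¬(2 ∣ z₀.re ∧ 2 ∣ z₀.im) := by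
    rintro ⟨⟨a, ha⟩, ⟨b, hb⟩⟩
    refine hk' ⟨⟨a, ?_⟩, ⟨b, ?_⟩⟩
    · rw [hre, ha, pow_succ]; ring
    · rw [him, hb, pow_succ]; ring
  have habs1 : (z.re.natAbs : ℤ) = 2 ^ k * z₀.re.natAbs := by
    rw [hre, Int.natAbs_mul, Int.natAbs_pow]; simp
  have habs2 : (z.im.natAbs : ℤ) = 2 ^ k * z₀.im.natAbs := by
    rw [him, Int.natAbs_mul, Int.natAbs_pow]; simp
  rcases Nat.lt_or_ge n (2 * k) with hn | hn
  · -- `n < 2k`: `z = 2^k z₀ ∉ B_n`, and the bounds fail too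
    constructor
    · intro h; exact absurd h (hzz ▸ two_pow_mul_not_mem_digitSet hz₀ hn)
    · rintro ⟨h1, h2, -⟩
      rw [habs1] at h1
      rw [habs2] at h2
      exact (not_bounds_of_lt hz₀ hn h1 h2).elim
  · obtain ⟨m, rfl⟩ := Nat.exists_eq_add_of_le' hn
    rw [habs1, habs2, hzz, two_pow_mul_mem_digitSet_iff, mem_digitSet_iff_mem_octagon_of_not_two_dvd hodd,
      mem_octagon_iff, show m + 2 * k + 1 = (m + 1) + 2 * k by ring, width_add_two_mul, width_add_two_mul,
      show (2 : ℤ) ^ k * width m - 2 ^ (k + 1) = 2 ^ k * (width m - 2) by ring,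
      show (2 : ℤ) ^ k * width (m + 1) - 3 * 2 ^ k = 2 ^ k * (width (m + 1) - 3) by ring, ← mul_add,
      scale_iff hP, scale_iff hP, scale_iff hP]

/-- **Theorem 2.5, sufficient form**: a non-zero `z` all of whose common powers of two `2^k ∣ (re z, im z)`
satisfy the `k`-th bounds lies in `B_n`. [cite: Graves2023, Thm. 2.5 (p. 3)] -/
theorem mem_digitSet_of_forall_pow_dvd {n : ℕ} {z : ℤ√(-1)} (hz : z ≠ 0)
    (h : ∀ k : ℕ, (2 : ℤ) ^ k ∣ z.re → (2 : ℤ) ^ k ∣ z.im →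
      (z.re.natAbs : ℤ) ≤ width n - 2 ^ (k + 1) ∧ (z.im.natAbs : ℤ) ≤ width n - 2 ^ (k + 1) ∧
        (z.re.natAbs : ℤ) + z.im.natAbs ≤ width (n + 1) - 3 * 2 ^ k) :
    z ∈ digitSet n := by
  have hz' : ¬(z.re = 0 ∧ z.im = 0) := fun h' ↦ hz (Zsqrtd.ext h'.1 h'.2)
  obtain ⟨k, ⟨hk1, hk2⟩, hk3⟩ := exists_exact_two_pow hz'
  exact (mem_digitSet_iff_of_exact hz ⟨hk1, hk2⟩ hk3).mpr (h k hk1 hk2)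

/-- **Theorem 2.5, necessary form**: an element of `B_n` with `2^k ∣ (re z, im z)` satisfies the `k`-th
bounds. [cite: Graves2023, Thm. 2.5 (p. 3)] -/
theorem bounds_of_mem_digitSet {n k : ℕ} {z : ℤ√(-1)} (hzB : z ∈ digitSet n) (hz : z ≠ 0)
    (hk1 : (2 : ℤ) ^ k ∣ z.re) (hk2 : (2 : ℤ) ^ k ∣ z.im) :
    (z.re.natAbs : ℤ) ≤ width n - 2 ^ (k + 1) ∧ (z.im.natAbs : ℤ) ≤ width n - 2 ^ (k + 1) ∧
      (z.re.natAbs : ℤ) + z.im.natAbs ≤ width (n + 1) - 3 * 2 ^ k := by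
  have hz' : ¬(z.re = 0 ∧ z.im = 0) := fun h' ↦ hz (Zsqrtd.ext h'.1 h'.2)
  obtain ⟨j, ⟨hj1, hj2⟩, hj3⟩ := exists_exact_two_pow hz'
  obtain ⟨h1, h2, h3⟩ := (mem_digitSet_iff_of_exact hz ⟨hj1, hj2⟩ hj3).mp hzB
  have hkj : k ≤ j := by
    by_contra hlt
    have hd : (2 : ℤ) ^ (j + 1) ∣ 2 ^ k := pow_dvd_pow 2 (by omega)
    exact hj3 ⟨hd.trans hk1, hd.trans hk2⟩
  have hpow : (2 : ℤ) ^ k ≤ 2 ^ j := pow_le_pow_right₀ (by norm_num) hkj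
  rw [pow_succ] at h1 h2 ⊢
  exact ⟨by linarith, by linarith, by linarith⟩

/-- **Theorem 2.5** as printed: `B_n ∖ 0 = ⋃_{j ≤ n/2} {x+iy : 2^j ∥ (x,y); |x|,|y| ≤ w_n − 2^{j+1};
|x|+|y| ≤ w_{n+1} − 3·2^j}`. [cite: Graves2023, Thm. 2.5 (p. 3)] -/
theorem mem_digitSet_iff {n : ℕ} {z : ℤ√(-1)} : z ∈ digitSet n ↔ z = 0 ∨ ∃ j : ℕ, 2 * j ≤ n ∧
    ((2 : ℤ) ^ j ∣ z.re ∧ (2 : ℤ) ^ j ∣ z.im) ∧ ¬((2 : ℤ) ^ (j + 1) ∣ z.re ∧ (2 : ℤ) ^ (j + 1) ∣ z.im) ∧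
    |z.re| ≤ width n - 2 ^ (j + 1) ∧ |z.im| ≤ width n - 2 ^ (j + 1) ∧ |z.re| + |z.im| ≤ width (n + 1) - 3 * 2 ^ j := by
  by_cases hz : z = 0
  · simp only [hz, zero_mem_digitSet, true_or]
  have hz' : ¬(z.re = 0 ∧ z.im = 0) := fun h' ↦ hz (Zsqrtd.ext h'.1 h'.2)
  obtain ⟨k, hk, hk'⟩ := exists_exact_two_pow hz'
  rw [mem_digitSet_iff_of_exact hz hk hk']
  simp only [hz, false_or, ← Int.natCast_natAbs]
  constructor
  · rintro ⟨h1, h2, h3⟩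
    refine ⟨k, ?_, hk, hk', h1, h2, h3⟩
    by_contra hn
    obtain ⟨z₀, hzz, hre, him⟩ := eq_two_pow_mul hk.1 hk.2
    have hz₀ : z₀ ≠ 0 := by rintro rfl; exact hz (by rw [hzz, mul_zero])
    have habs1 : (z.re.natAbs : ℤ) = 2 ^ k * z₀.re.natAbs := by
      rw [hre, Int.natAbs_mul, Int.natAbs_pow]; simp
    have habs2 : (z.im.natAbs : ℤ) = 2 ^ k * z₀.im.natAbs := by
      rw [him, Int.natAbs_mul, Int.natAbs_pow]; simp
    rw [habs1] at h1
    rw [habs2] at h2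
    exact not_bounds_of_lt hz₀ (by omega) h1 h2
  · rintro ⟨j, -, hj, hj', h1, h2, h3⟩
    obtain rfl := exact_two_pow_unique hj hj' hk hk'
    exact ⟨h1, h2, h3⟩

/-! ## §5 Corollary 2.7: `xy ∈ B_n ∖ 0 ⇒ x ∈ B_n` -/

/-- If `xy ∈ Oct_n` and `N(y) ≥ 2` then `x ∈ Oct_n` (`|x|_∞ ≤ |xy|/√2 ≤ |xy|_∞`, `|x|_1 ≤ √2|x| ≤ |xy| ≤ |xy|_1`;
the printed proof reaches the same bounds by a sign discussion). [cite: Graves2023, Cor. 2.7 (p. 5)] -/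
theorem mem_octagon_of_mul_mem_octagon {n : ℕ} {x y : ℤ√(-1)} (h : x * y ∈ octagon n) (hy : 2 ≤ y.norm) :
    x ∈ octagon n := by
  obtain ⟨a, b⟩ := x
  obtain ⟨c, d⟩ := y
  simp only [octagon, Set.mem_setOf_eq, re_mul, im_mul, norm_def] at h hy ⊢
  obtain ⟨h1, h2, h3⟩ := h
  have hw := three_le_width n
  have hw' := three_le_width (n + 1)
  have hN : (a * c + -1 * b * d) * (a * c + -1 * b * d) + (a * d + b * c) * (a * d + b * c) =
      (a * a + b * b) * (c * c - -1 * d * d) := by ring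
  have hU := abs_mul_abs_self (a * c + -1 * b * d)
  have hV := abs_mul_abs_self (a * d + b * c)
  have hUn := abs_nonneg (a * c + -1 * b * d)
  have hVn := abs_nonneg (a * d + b * c)
  have ha := abs_mul_abs_self a
  have hb := abs_mul_abs_self b
  have han := abs_nonneg a
  have hbn := abs_nonneg b
  have hsq : |a * c + -1 * b * d| * |a * c + -1 * b * d| ≤ (width n - 2) * (width n - 2) :=
    mul_self_le_mul_self hUn h1
  have hsq' : |a * d + b * c| * |a * d + b * c| ≤ (width n - 2) * (width n - 2) :=
    mul_self_le_mul_self hVn h2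
  have key : 2 * (a * a + b * b) ≤ (a * a + b * b) * (c * c - -1 * d * d) := by nlinarith
  refine ⟨?_, ?_, ?_⟩
  · nlinarith
  · nlinarith
  · have hs : (|a * c + -1 * b * d| + |a * d + b * c|) * (|a * c + -1 * b * d| + |a * d + b * c|) ≤
        (width (n + 1) - 3) * (width (n + 1) - 3) := mul_self_le_mul_self (by positivity) h3
    have e1 : (|a| + |b|) * (|a| + |b|) ≤ 2 * (a * a + b * b) := by
      nlinarith [mul_self_nonneg (|a| - |b|)]
    have e2 : 2 * (a * a + b * b) ≤
        (a * c + -1 * b * d) * (a * c + -1 * b * d) + (a * d + b * c) * (a * d + b * c) := by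
      rw [hN]; exact key
    have e3 : (a * c + -1 * b * d) * (a * c + -1 * b * d) + (a * d + b * c) * (a * d + b * c) ≤
        (|a * c + -1 * b * d| + |a * d + b * c|) * (|a * c + -1 * b * d| + |a * d + b * c|) := by
      nlinarith
    exact (mul_self_le_mul_self_iff (by positivity) (by linarith)).mpr (e1.trans (e2.trans (e3.trans hs)))

/-- A Gaussian integer of norm `1` is a digit (a unit). [cite: Graves2023, Def. 2.1 (p. 3)] -/
theorem mem_digits_of_norm_eq_one {y : ℤ√(-1)} (hy : y.norm = 1) : y ∈ digits := by
  rw [mem_digits_iff_natAbs]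
  rw [norm_def] at hy
  have h1 : y.re * y.re ≤ 1 := by nlinarith [mul_self_nonneg y.im, mul_self_nonneg y.re]
  have h2 : y.im * y.im ≤ 1 := by nlinarith [mul_self_nonneg y.im, mul_self_nonneg y.re]
  have h3 : -1 ≤ y.re ∧ y.re ≤ 1 := by constructor <;> nlinarith
  have h4 : -1 ≤ y.im ∧ y.im ≤ 1 := by constructor <;> nlinarith
  obtain ⟨a, b⟩ := y
  dsimp only at *
  obtain ⟨h3, h3'⟩ := h3
  obtain ⟨h4, h4'⟩ := h4
  interval_cases a <;> interval_cases b <;> simp_all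

/-- **Corollary 2.7**: «If `xy ∈ B_n ∖ 0`, then `x ∈ B_n`.» [cite: Graves2023, Cor. 2.7 (p. 5)] -/
theorem mem_digitSet_of_mul_mem {n : ℕ} {x y : ℤ√(-1)} (h : x * y ∈ digitSet n) (h0 : x * y ≠ 0) :
    x ∈ digitSet n := by
  have hy0 : y ≠ 0 := fun hy ↦ h0 (by rw [hy, mul_zero])
  have hyN : y.norm ≠ 0 := fun hN ↦ hy0 ((norm_eq_zero_iff (by norm_num) y).mp hN)
  have hyN' := norm_nonneg (by norm_num : (-1 : ℤ) ≤ 0) y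
  -- `y` a unit: `x = (xy)·ȳ`
  rcases eq_or_lt_of_le (show 1 ≤ y.norm by omega) with hN1 | hN2
  · have hx : x = x * y * star y := by
      rw [mul_assoc, ← norm_eq_mul_conj, ← hN1]; simp
    rw [hx, mul_comm]
    exact digit_mul_mem_digitSet (star_mem_digits (mem_digits_of_norm_eq_one hN1.symm)) h
  -- `N(y) ≥ 2`: strip factors `1+i` from `x`, then use the octagon
  induction n generalizing x with
  | zero =>
    rcases Int.emod_two_eq_zero_or_one (x.re + x.im) with hx | hx
    · obtain ⟨x', rfl⟩ := oneAddI_dvd_iff.mpr (Int.dvd_of_emod_eq_zero hx)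
      rw [mul_assoc, digitSet_zero] at h
      exact absurd (by rw [mul_assoc, eq_zero_of_oneAddI_mul_mem_digits h, mul_zero]) h0
    · exact mem_digitSet_of_not_two_dvd (fun ⟨h1, h2⟩ ↦ by omega)
        (mem_octagon_of_mul_mem_octagon (mem_octagon_of_mem_digitSet h) (by omega))
  | succ n ih =>
    rcases Int.emod_two_eq_zero_or_one (x.re + x.im) with hx | hx
    · obtain ⟨x', rfl⟩ := oneAddI_dvd_iff.mpr (Int.dvd_of_emod_eq_zero hx)
      rw [mul_assoc] at h h0
      exact oneAddI_mul_mem_digitSet_succ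
        (ih (mem_digitSet_of_oneAddI_mul_mem h) (fun h' ↦ h0 (by rw [h', mul_zero])))
    · exact mem_digitSet_of_not_two_dvd (fun ⟨h1, h2⟩ ↦ by omega)
        (mem_octagon_of_mul_mem_octagon (mem_octagon_of_mem_digitSet h) (by omega))

/-- Divisors of non-zero elements of `B_n` are in `B_n` (Corollary 2.7 in divisibility form).
[cite: Graves2023, Cor. 2.7 (p. 5)] -/
theorem mem_digitSet_of_dvd {n : ℕ} {x z : ℤ√(-1)} (hxz : x ∣ z) (hz : z ∈ digitSet n) (hz0 : z ≠ 0) :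
    x ∈ digitSet n := by
  obtain ⟨y, rfl⟩ := hxz
  exact mem_digitSet_of_mul_mem hz hz0

/-! ## §6 Corollary 2.6, middle inclusion: `Oct_n ⊂ B_{n+1} ∪ (1+i)^{n+2}(ℤ[i])^×` -/

/-- Powers of two between `K` and `2K`: for `P = 2^k`, `K = 2^m`, either `P ≤ K` or `2K ≤ P`. [folklore] -/
private theorem two_pow_le_or_le (k m : ℕ) : (2 : ℤ) ^ k ≤ 2 ^ m ∨ 2 * 2 ^ m ≤ (2 : ℤ) ^ k := by
  rcases Nat.lt_or_ge m k with h | h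
  · right; rw [← pow_succ']; exact pow_le_pow_right₀ (by norm_num) h
  · left; exact pow_le_pow_right₀ (by norm_num) h

/-- `2^j = (−i)^j (1+i)^{2j}`. [cite: Graves2023, §1 (p. 2)] -/
theorem two_pow_eq (j : ℕ) : (2 : ℤ√(-1)) ^ j = ⟨0, -1⟩ ^ j * ⟨1, 1⟩ ^ (2 * j) := by
  rw [two_eq, mul_pow, ← pow_two, ← pow_mul]

/-- A Gaussian integer with `|re| + |im| = 1` is a unit. [cite: Graves2023, Def. 2.1 (p. 3)] -/
theorem isUnit_of_natAbs_add_eq_one {u : ℤ√(-1)} (hu : u.re.natAbs + u.im.natAbs = 1) : IsUnit u := by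
  obtain ⟨x, y⟩ := u
  dsimp only at hu
  have hx : -1 ≤ x ∧ x ≤ 1 := by omega
  have hy : -1 ≤ y ∧ y ≤ 1 := by omega
  obtain ⟨hx1, hx2⟩ := hx
  obtain ⟨hy1, hy2⟩ := hy
  interval_cases x <;> interval_cases y <;> first
    | (exfalso; omega)
    | exact IsUnit.of_mul_eq_one ⟨-1, 0⟩ (by decide)
    | exact IsUnit.of_mul_eq_one ⟨1, 0⟩ (by decide)
    | exact IsUnit.of_mul_eq_one ⟨0, 1⟩ (by decide)
    | exact IsUnit.of_mul_eq_one ⟨0, -1⟩ (by decide)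

/-- **Corollary 2.6, middle inclusion**: «`Oct_n ⊂ B_{n+1} ∪ {(1+i)^{n+2}(ℤ[i])^×}`» — an element of `Oct_n` lies
in `B_{n+1}` or is a unit multiple of `(1+i)^{n+2}` (the latter happens exactly for `2^{m+1}·unit` when
`n = 2m` and for `2^{m+1}(±1±i)` when `n = 2m+1`). [cite: Graves2023, Cor. 2.6 (p. 4)] -/
theorem mem_digitSet_succ_or_of_mem_octagon {n : ℕ} {z : ℤ√(-1)} (hz : z ∈ octagon n) :
    z ∈ digitSet (n + 1) ∨ ∃ u : ℤ√(-1), IsUnit u ∧ z = u * ⟨1, 1⟩ ^ (n + 2) := by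
  by_cases hz0 : z = 0
  · exact Or.inl (hz0 ▸ zero_mem_digitSet _)
  have hz' : ¬(z.re = 0 ∧ z.im = 0) := fun h' ↦ hz0 (Zsqrtd.ext h'.1 h'.2)
  obtain ⟨k, ⟨hk1, hk2⟩, hk3⟩ := exists_exact_two_pow hz'
  obtain ⟨z₀, hzz, hre, him⟩ := eq_two_pow_mul hk1 hk2
  have hz₀ : z₀ ≠ 0 := by rintro rfl; exact hz0 (by rw [hzz, mul_zero])
  have hz₀' : 1 ≤ (z₀.re.natAbs : ℤ) + z₀.im.natAbs := by
    by_contra hlt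
    exact hz₀ (Zsqrtd.ext (by simp; omega) (by simp; omega))
  have habs1 : (z.re.natAbs : ℤ) = 2 ^ k * z₀.re.natAbs := by
    rw [hre, Int.natAbs_mul, Int.natAbs_pow]; simp
  have habs2 : (z.im.natAbs : ℤ) = 2 ^ k * z₀.im.natAbs := by
    rw [him, Int.natAbs_mul, Int.natAbs_pow]; simp
  have hP : (0 : ℤ) < 2 ^ k := pow_pos two_pos k
  obtain ⟨K, hK, hW⟩ := width_shape n
  have hKpos : (0 : ℤ) < K := by rw [hK]; positivity
  have hW2 : width (n + 1 + 1) = 2 * width n := width_add_two n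
  have hoct := mem_octagon_iff.mp hz
  rw [habs1, habs2] at hoct
  obtain ⟨h1, h2, h3⟩ := hoct
  rcases two_pow_le_or_le k (n / 2) with hPK | hPK <;> rw [← hK] at hPK
  · -- `2^k ≤ K`: the gains put `z` in `B_{n+1}`
    left
    have hdK : (2 : ℤ) ^ k ∣ K := by rw [hK] at hPK ⊢; exact pow_dvd_pow 2 ((pow_le_pow_iff_right₀ (by norm_num)).mp hPK)
    have hdW : (2 : ℤ) ^ k ∣ width n ∧ (2 : ℤ) ^ k ∣ width (n + 1) := by
      rcases hW with ⟨h0, h1⟩ | ⟨h0, h1⟩ <;> rw [h0, h1] <;> exact ⟨hdK.mul_left _, hdK.mul_left _⟩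
    have g1 : (2 : ℤ) ^ k ≤ width n - 2 ^ k * z₀.re.natAbs :=
      Int.le_of_dvd (by omega) (dvd_sub hdW.1 (dvd_mul_right _ _))
    have g2 : (2 : ℤ) ^ k ≤ width n - 2 ^ k * z₀.im.natAbs :=
      Int.le_of_dvd (by omega) (dvd_sub hdW.1 (dvd_mul_right _ _))
    have g3 : (2 : ℤ) ^ k ≤ width (n + 1) - (2 ^ k * z₀.re.natAbs + 2 ^ k * z₀.im.natAbs) :=
      Int.le_of_dvd (by omega) (dvd_sub hdW.2 (dvd_add (dvd_mul_right _ _) (dvd_mul_right _ _)))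
    refine (mem_digitSet_iff_of_exact hz0 ⟨hk1, hk2⟩ hk3).mpr ⟨?_, ?_, ?_⟩ <;>
      simp only [habs1, habs2, pow_succ] <;> omega
  · -- `2^k ≥ 2K`: `z₀` has coordinates in `{0, ±1}` and `2^k = 2K`
    have hsmall : (2 : ℤ) ^ k * z₀.re.natAbs < 2 ^ k * 2 ∧ (2 : ℤ) ^ k * z₀.im.natAbs < 2 ^ k * 2 := by
      constructor <;> omega
    have hre1 : (z₀.re.natAbs : ℤ) ≤ 1 := by
      have := Int.lt_of_mul_lt_mul_left hsmall.1 hP.le; omega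
    have him1 : (z₀.im.natAbs : ℤ) ≤ 1 := by
      have := Int.lt_of_mul_lt_mul_left hsmall.2 hP.le; omega
    have hb : (2 : ℤ) ^ k * z₀.re.natAbs = 0 ∨ (2 : ℤ) ^ k * z₀.re.natAbs = 2 ^ k := by
      rcases (by omega : z₀.re.natAbs = 0 ∨ z₀.re.natAbs = 1) with h | h <;> simp [h]
    have hc : (2 : ℤ) ^ k * z₀.im.natAbs = 0 ∨ (2 : ℤ) ^ k * z₀.im.natAbs = 2 ^ k := by
      rcases (by omega : z₀.im.natAbs = 0 ∨ z₀.im.natAbs = 1) with h | h <;> simp [h]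
    have hPK' : (2 : ℤ) ^ k = 2 * K := by
      rcases two_pow_le_or_le k (n / 2 + 1) with h | h <;> rw [pow_succ, ← hK] at h
      · omega
      · exfalso
        have : (2 : ℤ) ^ k * 1 ≤ 2 ^ k * (z₀.re.natAbs + z₀.im.natAbs) := Int.mul_le_mul_of_nonneg_left hz₀' hP.le
        rw [mul_one, mul_add] at this
        omega
    have hk : k = n / 2 + 1 := by
      have h : (2 : ℤ) ^ k = 2 ^ (n / 2 + 1) := by rw [pow_succ, ← hK, hPK']; ring
      exact Nat.pow_right_injective le_rfl (by exact_mod_cast h)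
    -- the odd part `z₀` is a unit or a unit times `1+i`
    by_cases hunit : z₀.re.natAbs + z₀.im.natAbs = 1
    · have hu := isUnit_of_natAbs_add_eq_one hunit
      obtain ⟨m, rfl | rfl⟩ := Nat.even_or_odd' n
      · -- `n = 2m`: `z = 2^{m+1} z₀ = z₀ (−i)^{m+1} (1+i)^{2m+2}` is the exceptional unit multiple
        right
        refine ⟨z₀ * ⟨0, -1⟩ ^ (m + 1), hu.mul ((IsUnit.of_mul_eq_one ⟨0, 1⟩ (by decide)).pow _), ?_⟩
        rw [hzz, hk, Nat.mul_div_right m two_pos, two_pow_eq, show 2 * (m + 1) = 2 * m + 2 by ring]; ring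
      · -- `n = 2m+1`: `z = 2^{m+1} z₀ = unit · (1+i)^{2m+2} ∈ B_{n+1}`
        left
        have hd : (⟨0, -1⟩ ^ (m + 1) * z₀ : ℤ√(-1)) ∈ digits := by
          refine mem_digits_of_norm_eq_one ((norm_eq_one_iff' (by norm_num) _).mpr ?_)
          exact ((IsUnit.of_mul_eq_one ⟨0, 1⟩ (by decide)).pow _).mul hu
        have hmem := pow_mul_mem_digitSet (digits_subset_digitSet 0 hd) (2 * m + 1 + 1)
        rw [zero_add] at hmem
        rw [hzz, hk, show (2 * m + 1) / 2 = m by omega, two_pow_eq,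
          show (⟨0, -1⟩ : ℤ√(-1)) ^ (m + 1) * ⟨1, 1⟩ ^ (2 * (m + 1)) * z₀ =
            ⟨1, 1⟩ ^ (2 * m + 1 + 1) * (⟨0, -1⟩ ^ (m + 1) * z₀) by
              rw [show 2 * (m + 1) = 2 * m + 1 + 1 by ring]; ring]
        exact hmem
    · -- `z₀ = ±1 ± i = unit · (1+i)`
      have h11 : z₀.re.natAbs = 1 ∧ z₀.im.natAbs = 1 := by omega
      obtain ⟨w, hw⟩ := oneAddI_dvd_iff.mpr (by omega : 2 ∣ z₀.re + z₀.im)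
      have hwre := congrArg Zsqrtd.re hw
      have hwim := congrArg Zsqrtd.im hw
      simp only [re_mul, im_mul] at hwre hwim
      have hwu : IsUnit w := isUnit_of_natAbs_add_eq_one (by omega)
      obtain ⟨m, rfl | rfl⟩ := Nat.even_or_odd' n
      · -- `n = 2m`: `|re| + |im| = 2^{m+2} = 4K > w_{n+1} − 3`: not in `Oct_n`
        exfalso
        simp only [h11.1, h11.2, Nat.cast_one, mul_one] at h3
        rcases hW with ⟨h0, h1'⟩ | ⟨h0, h1'⟩
        · omega
        · -- impossible shape for even `n`
          have := width_two_mul m; rw [Nat.mul_div_right m two_pos] at hK; omega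
      · -- `n = 2m+1`: `z = 2^{m+1}(1+i)w = unit · (1+i)^{2m+3}`
        right
        refine ⟨w * ⟨0, -1⟩ ^ (m + 1), hwu.mul ((IsUnit.of_mul_eq_one ⟨0, 1⟩ (by decide)).pow _), ?_⟩
        rw [hzz, hk, show (2 * m + 1) / 2 = m by omega, two_pow_eq, hw,
          show 2 * m + 1 + 2 = 2 * (m + 1) + 1 by ring, pow_succ]
        ring

end Literature.NumberTheory.QuadraticFields.GaussianDigits
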